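import Literature.NumberTheory.LFunctions.WeilGroundEnergyParitySplit
import Literature.NumberTheory.LFunctions.WeilWindowSuzukiContinuityProofs
import HarnessLib

/-!
# Route WeilParity — crux `EvenWinsBeyondArch` (stmt-RiemannHypothesis-15432), sector continuity

Support file for line `birth` of the crux `EvenWinsBeyondArch`: the stub `stub_sectorContinuity`,
continuity in the window `a ∈ (0, ∞)` of BOTH parity-sector bottoms of Weil's windowed quadratic
form, `ε_ev(a) = weilEvenGroundEnergy a` and `ε_od(a) = weilOddGroundEnergy a`
(`Literature/NumberTheory/LFunctions/WeilGroundEnergyParitySplit.lean`,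
`Literature/NumberTheory/LFunctions/WeilOddGroundState.lean`): Bombieri's `μ⁺(e^a)`, `μ⁻(e^a)`
(E. Bombieri, *Remarks on Weil's quadratic functional in the theory of prime numbers I*, Rend. Mat.
Acc. Lincei (9) 11 (2000), §4 Thm. 5, p. 197: "`μ⁺(M)` and `μ⁻(M)` are continuous decreasing
functions of `M`" — this file is the CONTINUITY half; the monotone half is
`weilEvenGroundEnergy_antitoneOn` / `weilOddGroundEnergy_antitoneOn` in the tree). RH-free.

## Proof

The tree proves continuity of the parity-free bottom `ε(a) = weilGroundEnergy a`
(`Literature.NumberTheory.LFunctions.continuousAt_weilGroundEnergy`,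
`WeilWindowSuzukiContinuityProofs.lean`, Suzuki 2026 Thm. 1.3) from the UNIFORM dilation modulus
`exists_weilDilate_modulus`: `|Re Q(g_η) − Re Q(g)| ≤ ε` for `|η| ≤ δ(a, E, ε)`, uniformly over
`L²`-normalised tests `g` on `[-a, a]` with `Re Q(g) ≤ E`, where `g_η = weilDilate η g`,
`g_η(t) = (1+η)^{1/2} g((1+η)t)` is Bombieri's variation `f_ε` (proof of Thm. 5). The modulus is
parity-blind and the dilation PRESERVES parity (`g(-t) = σ g(t) ⇒ g_η(-t) = σ g_η(t)`,
`stub_sectorContinuity_weilDilate_parity`), so the same two-sided argument runs inside any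
dilation-stable constraint class `P` whose unit spheres are nonempty
(`stub_sectorContinuity_continuousAt_sInf`, for the value sets `weilWindowSphereValues P a`):
upper bound near `a₀` by dilating a near-minimiser of the window `a₀` into the window `a`
(`η = a₀/a − 1`), lower bound by dilating every energy-bounded element of the sphere of the window
`a ≤ 2a₀` into the window `a₀` (`η = a/a₀ − 1`). The two sectors are the instances
`P g = (∀ t, g(-t) = g t)` and `P g = (∀ t, g(-t) = -g t)` (`weilEvenGroundEnergy_eq_sInf`,
`weilOddGroundEnergy_eq_sInf`, both `rfl`).

No new definitions, no named facts; Mathlib + the two imported tree files only.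
-/

noncomputable section

open Set MeasureTheory Filter
open scoped Real Topology

namespace Summit.RiemannHypothesis.RiemannHypothesis.Theorems

open Literature.NumberTheory.LFunctions

set_option linter.dupNamespace false in
/-- **The dilation preserves parity.** If `g(-t) = σ g(t)` for all `t` (σ = 1: even, σ = -1: odd),
then Bombieri's dilate `g_η(t) = (1+η)^{1/2} g((1+η)t)` satisfies `g_η(-t) = σ g_η(t)` for every
`η` (unfold and use `(1+η)(-t) = -((1+η)t)`). [folklore] -/
theorem stub_sectorContinuity_weilDilate_parity {g : ℝ → ℂ} {σ : ℂ} (hg : ∀ t, g (-t) = σ * g t)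
    (η t : ℝ) : weilDilate η g (-t) = σ * weilDilate η g t := by
  rw [weilDilate_apply, weilDilate_apply, mul_neg, hg]
  ring

set_option linter.dupNamespace false in
/-- **Continuity of a dilation-stable restricted ground energy at every window `a₀ > 0`.** For a
constraint `P` on test functions that is stable under the dilations `weilDilate η`, `η > -1`, and
whose restricted unit spheres `weilWindowSphereValues P a` are nonempty for every `a > 0`, the
restricted bottom `a ↦ sInf (weilWindowSphereValues P a)` is continuous at `a₀`. Upper bound near
`a₀`: dilate a near-minimiser of the window `a₀` into the window `a` (`η = a₀/a − 1`). Lower bound: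
dilate every element of the sphere of the window `a ≤ 2a₀` with energy `≤ sInf + 1` into the window
`a₀` (`η = a/a₀ − 1`); elements of larger energy need no argument. Both use the parity-blind uniform
modulus `exists_weilDilate_modulus` (the tree's proof of Suzuki 2026 Thm. 1.3,
`continuousAt_weilGroundEnergy`, run inside the class `P`; Bombieri 2000 Thm. 5 for the parity
classes). [cite: Bombieri2000Weil, §4 Thm. 5 (p. 197)] -/
theorem stub_sectorContinuity_continuousAt_sInf {P : (ℝ → ℂ) → Prop}
    (hP : ∀ η : ℝ, -1 < η → ∀ g : ℝ → ℂ, P g → P (weilDilate η g))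
    (hne : ∀ a : ℝ, 0 < a → (weilWindowSphereValues P a).Nonempty) {a₀ : ℝ} (ha₀ : 0 < a₀) :
    ContinuousAt (fun a ↦ sInf (weilWindowSphereValues P a)) a₀ := by
  rw [Metric.continuousAt_iff]
  intro ε hε
  obtain ⟨x, hxS, hlt⟩ := exists_lt_of_csInf_lt (hne a₀ ha₀)
    (lt_add_of_pos_right (sInf (weilWindowSphereValues P a₀)) (half_pos hε))
  obtain ⟨g₀, hg₀, hs₀, hP₀, hn₀, rfl⟩ := hxS
  obtain ⟨δ₁, hδ₁, -, h₁⟩ := exists_weilDilate_modulus ha₀ ((weilQuadratic g₀).re) (half_pos hε)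
  obtain ⟨δ₂, hδ₂, -, h₂⟩ :=
    exists_weilDilate_modulus (a := 2 * a₀) (by positivity)
      (sInf (weilWindowSphereValues P a₀) + 1) (half_pos hε)
  refine ⟨min (a₀ / 2) (min (δ₁ * a₀ / 2) (δ₂ * a₀ / 2)), by positivity, fun a ha ↦ ?_⟩
  rw [Real.dist_eq] at ha ⊢
  have ha1 : |a - a₀| < a₀ / 2 := lt_of_lt_of_le ha (min_le_left _ _)
  have ha2 : |a - a₀| < δ₁ * a₀ / 2 :=
    lt_of_lt_of_le ha ((min_le_right _ _).trans (min_le_left _ _))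
  have ha3 : |a - a₀| < δ₂ * a₀ / 2 :=
    lt_of_lt_of_le ha ((min_le_right _ _).trans (min_le_right _ _))
  rw [abs_lt] at ha1 ha2 ha3
  have hapos : a₀ / 2 < a := by linarith [ha1.1]
  have ha0 : 0 < a := by linarith
  have hale : a ≤ 2 * a₀ := by linarith [ha1.2]
  rw [abs_sub_lt_iff]
  constructor
  · -- upper bound: `sInf S_P(a) < sInf S_P(a₀) + ε`
    set η : ℝ := a₀ / a - 1 with hη
    have hη1 : -1 < η := by
      have : 0 < a₀ / a := div_pos ha₀ ha0
      rw [hη]; linarith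
    have hηabs : |η| ≤ δ₁ := by
      rw [hη, show a₀ / a - 1 = (a₀ - a) / a by field_simp, abs_div, abs_of_pos ha0,
        div_le_iff₀ ha0, abs_sub_comm]
      nlinarith [ha2.1, ha2.2, abs_lt.2 ⟨ha2.1, ha2.2⟩]
    have hwin : a₀ / (1 + η) = a := by
      rw [show 1 + η = a₀ / a by rw [hη]; ring, div_div_eq_mul_div, mul_div_cancel_left₀ _ ha₀.ne']
    have hh : IsWeilTest (weilDilate η g₀) := hg₀.weilDilate hη1
    have hhs : tsupport (weilDilate η g₀) ⊆ Icc (-a) a := by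
      have := tsupport_weilDilate_subset g₀ hη1 hs₀
      rwa [hwin] at this
    have hhn : ∫ t : ℝ, ‖weilDilate η g₀ t‖ ^ 2 = 1 := by
      rw [integral_norm_sq_weilDilate g₀ hη1, hn₀]
    have hle : sInf (weilWindowSphereValues P a) ≤ (weilQuadratic (weilDilate η g₀)).re :=
      sInf_weilWindowSphereValues_le_re hh hhs (hP η hη1 g₀ hP₀) hhn
    have hkey := h₁ η hηabs g₀ hg₀ hs₀ hn₀ le_rfl
    rw [abs_le] at hkey
    linarith [hkey.2]
  · -- lower bound: `sInf S_P(a₀) − ε < sInf S_P(a)`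
    have hlb : sInf (weilWindowSphereValues P a₀) - ε / 2 ≤ sInf (weilWindowSphereValues P a) := by
      refine le_sInf_weilWindowSphereValues (hne a ha0) fun h hh hhs hPh hhn ↦ ?_
      by_cases hE : (weilQuadratic h).re ≤ sInf (weilWindowSphereValues P a₀) + 1
      · set η : ℝ := a / a₀ - 1 with hη
        have hη1 : -1 < η := by
          have : 0 < a / a₀ := div_pos ha0 ha₀
          rw [hη]; linarith
        have hηabs : |η| ≤ δ₂ := by
          rw [hη, show a / a₀ - 1 = (a - a₀) / a₀ by field_simp, abs_div, abs_of_pos ha₀,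
            div_le_iff₀ ha₀]
          nlinarith [ha3.1, ha3.2, abs_lt.2 ⟨ha3.1, ha3.2⟩]
        have hwin : a / (1 + η) = a₀ := by
          rw [show 1 + η = a / a₀ by rw [hη]; ring, div_div_eq_mul_div,
            mul_div_cancel_left₀ _ ha0.ne']
        have hhs' : tsupport h ⊆ Icc (-(2 * a₀)) (2 * a₀) :=
          hhs.trans (Icc_subset_Icc (by linarith) hale)
        have hh' : IsWeilTest (weilDilate η h) := hh.weilDilate hη1
        have hhs'' : tsupport (weilDilate η h) ⊆ Icc (-a₀) a₀ := by
          have := tsupport_weilDilate_subset h hη1 hhs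
          rwa [hwin] at this
        have hhn' : ∫ t : ℝ, ‖weilDilate η h t‖ ^ 2 = 1 := by
          rw [integral_norm_sq_weilDilate h hη1, hhn]
        have hle : sInf (weilWindowSphereValues P a₀) ≤ (weilQuadratic (weilDilate η h)).re :=
          sInf_weilWindowSphereValues_le_re hh' hhs'' (hP η hη1 h hPh) hhn'
        have hkey := h₂ η hηabs h hh hhs' hhn hE
        rw [abs_le] at hkey
        linarith [hkey.1]
      · have hE' := not_le.1 hE
        linarith
    linarith

set_option linter.dupNamespace false in
/-- **Continuity of the even-sector bottom at every window `a₀ > 0`**: `ε_ev = μ⁺(e^·)` is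
continuous at `a₀` (the class of even tests is dilation-stable and its unit spheres are nonempty,
`weilWindowSphereValues_even_nonempty`). [cite: Bombieri2000Weil, §4 Thm. 5 (p. 197)] -/
theorem stub_sectorContinuity_continuousAt_even {a₀ : ℝ} (ha₀ : 0 < a₀) :
    ContinuousAt weilEvenGroundEnergy a₀ := by
  have h := stub_sectorContinuity_continuousAt_sInf (P := fun g : ℝ → ℂ ↦ ∀ t, g (-t) = g t)
    (fun η _ g hg t ↦ by
      have h1 := stub_sectorContinuity_weilDilate_parity (g := g) (σ := 1)
        (fun t ↦ by rw [hg t, one_mul]) η t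
      rwa [one_mul] at h1)
    (fun a ha ↦ weilWindowSphereValues_even_nonempty ha) ha₀
  exact h

set_option linter.dupNamespace false in
/-- **Continuity of the odd-sector bottom at every window `a₀ > 0`**: `ε_od = μ⁻(e^·)` is
continuous at `a₀` (the class of odd tests is dilation-stable and its unit spheres are nonempty,
`weilWindowSphereValues_odd_nonempty`). [cite: Bombieri2000Weil, §4 Thm. 5 (p. 197)] -/
theorem stub_sectorContinuity_continuousAt_odd {a₀ : ℝ} (ha₀ : 0 < a₀) :
    ContinuousAt weilOddGroundEnergy a₀ := by
  have h := stub_sectorContinuity_continuousAt_sInf (P := fun g : ℝ → ℂ ↦ ∀ t, g (-t) = -g t)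
    (fun η _ g hg t ↦ by
      have h1 := stub_sectorContinuity_weilDilate_parity (g := g) (σ := -1)
        (fun t ↦ by rw [hg t, neg_one_mul]) η t
      rwa [neg_one_mul] at h1)
    (fun a ha ↦ weilWindowSphereValues_odd_nonempty ha) ha₀
  exact h

set_option linter.dupNamespace false in
/-- **Stub `stub_sectorContinuity` of line `birth` (crux `EvenWinsBeyondArch`, route `WeilParity`):
continuity of the sector bottoms in the window** (Bombieri 2000, Thm. 5, continuity half, for
`μ⁺(e^a) = ε_ev(a) = weilEvenGroundEnergy a` and `μ⁻(e^a) = ε_od(a) = weilOddGroundEnergy a`): both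
parity-sector ground energies of the windowed Weil form are continuous functions of `a ∈ (0, ∞)`.
RH-free: the tree's proof of `continuousAt_weilGroundEnergy` (Suzuki 2026 Thm. 1.3) run inside each
sector — the dilation `weilDilate η` maps even tests to even tests and odd to odd, and the uniform
modulus `exists_weilDilate_modulus` is parity-blind. [cite: Bombieri2000Weil, §4 Thm. 5 (p. 197)] -/
theorem stub_sectorContinuity :
    ContinuousOn weilEvenGroundEnergy (Set.Ioi (0 : ℝ)) ∧
      ContinuousOn weilOddGroundEnergy (Set.Ioi (0 : ℝ)) :=
  ⟨fun _ ha ↦ (stub_sectorContinuity_continuousAt_even ha).continuousWithinAt,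
    fun _ ha ↦ (stub_sectorContinuity_continuousAt_odd ha).continuousWithinAt⟩

end Summit.RiemannHypothesis.RiemannHypothesis.Theorems

end
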